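import Summits.RiemannHypothesis.RiemannHypothesis.Theorems.GroundBartaPolarPerronFrobeniusEvenPolarGain
import Summits.RiemannHypothesis.RiemannHypothesis.Theorems.GroundBartaPolarPerronFrobeniusSmallWindows
import Summits.RiemannHypothesis.RiemannHypothesis.Theorems.GroundBartaPolarPerronFrobeniusConeDenseOfEven
import Summits.RiemannHypothesis.RiemannHypothesis.Theorems.WeilParityEvenWinsBeyondArchFrontier63
import HarnessLib

/-!
# RiemannHypothesis / GroundBarta — crux `PolarPerronFrobenius` (stmt-RiemannHypothesis-18390):
# even-sector sign improvement, part E3c: EVEN CONE DENSITY and `GSP a` on every window `a ≤ 1/4`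

Helper file (`--supports stmt-RiemannHypothesis-18390`), RH-free, Mathlib + proved tree files only,
no definitions, no named facts.

The parity-free small-window theorem of this crux (`…SmallWindows.lean`) gives cone density and
`GSP a` for `0 < a ≤ 1/10` (pointwise kernel threshold `0.1406…`, sharp — barrier file
`…SignImprovingBarrier.lean`).  In the EVEN sector the symmetrised kernel inequality of parts E1–E3b
has threshold `0.277…`; this file records the consequences on every window `0 < a ≤ 1/4`:

* `swe_cone_of_real_even`, `swe_evenConeDense`: **the matrix of the registered RH-bearing stub
  `stub_evenConeDense_cofinal` holds unconditionally at every window `0 < a ≤ 1/4`** — every even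
  normalised window test is matched up to any `δ > 0` by an even CONE test (smooth, supported in
  `[-a, a]`, even, pointwise real and `≥ 0`, normalised);
* `swe_coneDense`: parity-free cone density at `0 < a ≤ 1/4`, from the even one through the landed
  funnel `stub_coneDense_of_even` (S2) and the certified parity order `ε_ev(a) ≤ ε_od(a)` for
  `a ≤ 63/100` (`WeilParity.evenSectorWins_upTo_63`, RH-free);
* `swe_exists_nonneg_isWeilGroundState`, `swe_exists_even_real_nonneg_isWeilGroundState`,
  `swe_GSP`, `swe_polarMatrix`: **`GSP a` for every `0 < a ≤ 1/4`** — the full windowed Weil form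
  has a ground state that is even, real and `≥ 0` (cone minimising sequence `stub_coneMinimizingSeq`,
  compactness `ConnesConsaniMoscovici2025_thm_3_6_holds`, sign in the limit `stub_aeNonneg_of_L2_limit`).

Prover B, speedrun unit `sr-gb-rung-b` (seat 2).
-/

set_option linter.dupNamespace false

noncomputable section

open Set MeasureTheory Filter Complex
open scoped Real Topology

namespace Summit.RiemannHypothesis.RiemannHypothesis.Theorems.PolarPerronFrobenius

open Literature.NumberTheory.LFunctions
open Summit.RiemannHypothesis.RiemannHypothesis.Theorems.OddSector
open Summit.RiemannHypothesis.RiemannHypothesis.Theses.GroundBarta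

/-! ## Even real tests -/

section RealBridge

variable {f : ℝ → ℝ} {a : ℝ}

/-- **Even real case, normalised.**  For `0 < a ≤ 1/4`, an EVEN real normalised window test `f` and
`δ > 0` there is a normalised, even, NON-NEGATIVE real window test `w` with `Re Q(w) ≤ Re Q(f) + δ`.
[folklore] -/
theorem swe_cone_of_real_even (ha : 0 < a) (ha' : a ≤ 1 / 4)
    (hF : IsWeilTest fun t ↦ ((f t : ℝ) : ℂ))
    (hsupp : tsupport (fun t ↦ ((f t : ℝ) : ℂ)) ⊆ Icc (-a) a) (hfe : ∀ t, f (-t) = f t)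
    (hnorm : ∫ t, ‖((f t : ℝ) : ℂ)‖ ^ 2 = 1) {δ : ℝ} (hδ : 0 < δ) :
    ∃ w : ℝ → ℂ, IsWeilTest w ∧ tsupport w ⊆ Icc (-a) a ∧ (∀ t, w (-t) = w t) ∧
      (∀ t, (w t).im = 0 ∧ 0 ≤ (w t).re) ∧ ∫ t, ‖w t‖ ^ 2 = 1 ∧
      (weilQuadratic w).re ≤ (weilQuadratic fun t ↦ ((f t : ℝ) : ℂ)).re + δ := by
  have hf := sw_contDiff_of_isWeilTest_ofReal hF
  have hfs := sw_hasCompactSupport_of_isWeilTest_ofReal hF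
  have hsuppR : tsupport f ⊆ Icc (-a) a := (sw_tsupport_ofReal_comp f) ▸ hsupp
  obtain ⟨η, hη, hNpos, hlt⟩ := swe_exists_nonneg_test_lt_even hf hfs ha ha' hsuppR hfe hnorm hδ
  set W : ℝ → ℂ := fun t ↦ ((Real.sqrt (f t ^ 2 + η ^ 2) - η : ℝ) : ℂ) with hWdef
  set N : ℝ := ∫ t, ‖W t‖ ^ 2 with hN
  have hW : IsWeilTest W := sw_isWeilTest_psi_comp hf hfs hη
  have hWs : tsupport W ⊆ Icc (-a) a := (sw_tsupport_psi_comp_subset hη.le).trans hsuppR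
  set c : ℝ := (Real.sqrt N)⁻¹ with hc
  have hcpos : 0 < c := inv_pos.2 (Real.sqrt_pos.2 hNpos)
  have hcc : c * c = 1 / N := by
    rw [hc, ← mul_inv, Real.mul_self_sqrt hNpos.le, one_div]
  refine ⟨fun t ↦ (c : ℂ) * W t, hW.const_mul c, tsupport_mul_subset_right.trans hWs,
    fun t ↦ ?_, fun t ↦ ?_, ?_, ?_⟩
  · simp only [hWdef]
    rw [hfe]
  · simp only [hWdef, ← Complex.ofReal_mul, Complex.ofReal_im, Complex.ofReal_re]
    exact ⟨trivial, mul_nonneg hcpos.le (sw_psi_nonneg hη.le _)⟩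
  · simp only [norm_mul, mul_pow, Complex.norm_real, Real.norm_of_nonneg hcpos.le]
    rw [integral_const_mul, ← hN, hc, inv_pow, Real.sq_sqrt hNpos.le, inv_mul_cancel₀ hNpos.ne']
  · have hQ' : (weilQuadratic fun t ↦ (c : ℂ) * W t).re = c * c * (weilQuadratic W).re := by
      rw [weilQuadratic_const_mul, Complex.normSq_ofReal, Complex.re_ofReal_mul]
    rw [hQ', hcc, one_div, inv_mul_eq_div, div_le_iff₀ hNpos]
    nlinarith [hlt]

/-- **Even real case, Rayleigh form** (`f` un-normalised, `0 < ‖f‖₂²`, `Re Q(f) ≤ ‖f‖₂² · C`).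
[folklore] -/
theorem swe_cone_of_real_even' (ha : 0 < a) (ha' : a ≤ 1 / 4)
    (hF : IsWeilTest fun t ↦ ((f t : ℝ) : ℂ))
    (hsupp : tsupport (fun t ↦ ((f t : ℝ) : ℂ)) ⊆ Icc (-a) a) (hfe : ∀ t, f (-t) = f t)
    (hN : 0 < ∫ t, ‖((f t : ℝ) : ℂ)‖ ^ 2) {C : ℝ}
    (hQ : (weilQuadratic fun t ↦ ((f t : ℝ) : ℂ)).re ≤ (∫ t, ‖((f t : ℝ) : ℂ)‖ ^ 2) * C)
    {δ : ℝ} (hδ : 0 < δ) :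
    ∃ w : ℝ → ℂ, IsWeilTest w ∧ tsupport w ⊆ Icc (-a) a ∧ (∀ t, w (-t) = w t) ∧
      (∀ t, (w t).im = 0 ∧ 0 ≤ (w t).re) ∧ ∫ t, ‖w t‖ ^ 2 = 1 ∧ (weilQuadratic w).re ≤ C + δ := by
  set N : ℝ := ∫ t, ‖((f t : ℝ) : ℂ)‖ ^ 2 with hNdef
  set c : ℝ := (Real.sqrt N)⁻¹ with hc
  have hcpos : 0 < c := inv_pos.2 (Real.sqrt_pos.2 hN)
  have hcc : c * c = 1 / N := by
    rw [hc, ← mul_inv, Real.mul_self_sqrt hN.le, one_div]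
  have e : (fun t ↦ ((c * f t : ℝ) : ℂ)) = fun t ↦ (c : ℂ) * ((f t : ℝ) : ℂ) := by
    funext t
    push_cast
    ring
  have hF1 : IsWeilTest fun t ↦ ((c * f t : ℝ) : ℂ) := by
    rw [e]
    exact hF.const_mul c
  have hsupp1 : tsupport (fun t ↦ ((c * f t : ℝ) : ℂ)) ⊆ Icc (-a) a := by
    rw [e]
    exact tsupport_mul_subset_right.trans hsupp
  have e' : ∀ t, ((c * f t : ℝ) : ℂ) = (c : ℂ) * ((f t : ℝ) : ℂ) := fun t ↦ by push_cast; ring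
  have hnorm1 : ∫ t, ‖((c * f t : ℝ) : ℂ)‖ ^ 2 = 1 := by
    have h1 : ∀ t, ‖((c * f t : ℝ) : ℂ)‖ ^ 2 = c ^ 2 * ‖((f t : ℝ) : ℂ)‖ ^ 2 := fun t ↦ by
      rw [e', norm_mul, mul_pow, Complex.norm_real, Real.norm_of_nonneg hcpos.le]
    simp only [h1]
    rw [integral_const_mul, ← hNdef, hc, inv_pow, Real.sq_sqrt hN.le, inv_mul_cancel₀ hN.ne']
  have hQ1 : (weilQuadratic fun t ↦ ((c * f t : ℝ) : ℂ)).re ≤ C := by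
    rw [e, weilQuadratic_const_mul, Complex.normSq_ofReal, Complex.re_ofReal_mul, hcc, one_div,
      inv_mul_eq_div, div_le_iff₀ hN]
    linarith
  have hfe1 : ∀ t, c * f (-t) = c * f t := fun t ↦ by rw [hfe]
  obtain ⟨w, hw, hws, hwe, hsign, hwn, hwQ⟩ :=
    swe_cone_of_real_even ha ha' hF1 hsupp1 hfe1 hnorm1 hδ
  exact ⟨w, hw, hws, hwe, hsign, hwn, by linarith⟩

end RealBridge

/-! ## Even cone density at every window `0 < a ≤ 1/4` -/

/-- **Even cone density for `0 < a ≤ 1/4`** — the matrix of the registered RH-bearing stub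
`stub_evenConeDense_cofinal` (line `Sketch`) holds UNCONDITIONALLY at every window `0 < a ≤ 1/4`:
every even normalised window test `h` is matched up to any `δ > 0` by an even cone test.  (Weil's
distribution is real: `Re Q(h) = Re Q(Re h) + Re Q(Im h)` with `Re h`, `Im h` even; one of them has
Rayleigh quotient `≤ Re Q(h)`; then the even real case.) [folklore] -/
theorem swe_evenConeDense {a : ℝ} (ha : 0 < a) (ha' : a ≤ 1 / 4) :
    ∀ h : ℝ → ℂ, IsWeilTest h → tsupport h ⊆ Set.Icc (-a) a → (∀ t, h (-t) = h t) →
      ∫ t, ‖h t‖ ^ 2 = (1 : ℝ) → ∀ δ : ℝ, 0 < δ →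
        ∃ w : ℝ → ℂ, IsWeilTest w ∧ tsupport w ⊆ Set.Icc (-a) a ∧ (∀ t, w (-t) = w t) ∧
          (∀ t, (w t).im = 0 ∧ 0 ≤ (w t).re) ∧ ∫ t, ‖w t‖ ^ 2 = (1 : ℝ) ∧
          (weilQuadratic w).re ≤ (weilQuadratic h).re + δ := by
  intro h hh hsupp hhe hnorm δ hδ
  have hR : IsWeilTest fun t ↦ (((h t).re : ℝ) : ℂ) := isWeilTest_rePart hh
  have hS : IsWeilTest fun t ↦ (((h t).im : ℝ) : ℂ) := isWeilTest_imPart hh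
  have hRs : tsupport (fun t ↦ (((h t).re : ℝ) : ℂ)) ⊆ Icc (-a) a :=
    (tsupport_rePart_subset h).trans hsupp
  have hSs : tsupport (fun t ↦ (((h t).im : ℝ) : ℂ)) ⊆ Icc (-a) a :=
    (tsupport_imPart_subset h).trans hsupp
  have hRe : ∀ t, (h (-t)).re = (h t).re := fun t ↦ by rw [hhe]
  have hSe : ∀ t, (h (-t)).im = (h t).im := fun t ↦ by rw [hhe]
  have hQ := re_weilQuadratic_eq_rePart_add_imPart hh
  have hNRS : (∫ t, ‖(((h t).re : ℝ) : ℂ)‖ ^ 2) + ∫ t, ‖(((h t).im : ℝ) : ℂ)‖ ^ 2 = 1 := by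
    rw [← hnorm]
    exact integral_norm_sq_rePart_add_imPart hh.memLp_two
  have hNR0 : 0 ≤ ∫ t, ‖(((h t).re : ℝ) : ℂ)‖ ^ 2 := integral_nonneg fun t ↦ by positivity
  have hNS0 : 0 ≤ ∫ t, ‖(((h t).im : ℝ) : ℂ)‖ ^ 2 := integral_nonneg fun t ↦ by positivity
  have hx0 : (∫ t, ‖(((h t).re : ℝ) : ℂ)‖ ^ 2) = 0 →
      (weilQuadratic fun t ↦ (((h t).re : ℝ) : ℂ)).re = 0 := fun h0 ↦ by
    rw [hR.eq_zero_of_integral_norm_sq_eq_zero h0, weilQuadratic_zero, Complex.zero_re]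
  have hy0 : (∫ t, ‖(((h t).im : ℝ) : ℂ)‖ ^ 2) = 0 →
      (weilQuadratic fun t ↦ (((h t).im : ℝ) : ℂ)).re = 0 := fun h0 ↦ by
    rw [hS.eq_zero_of_integral_norm_sq_eq_zero h0, weilQuadratic_zero, Complex.zero_re]
  rcases sw_select hNR0 hNS0 hNRS hQ.symm hx0 hy0 with ⟨hN, hle⟩ | ⟨hN, hle⟩
  · exact swe_cone_of_real_even' ha ha' hR hRs hRe hN hle hδ
  · exact swe_cone_of_real_even' ha ha' hS hSs hSe hN hle hδ

/-- **Cone density at every window `0 < a ≤ 1/4`** (parity-free): from even cone density through the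
landed funnel `stub_coneDense_of_even` (S2), fed with the RH-free parity order on `a ≤ 63/100`
(`WeilParity.evenSectorWins_upTo_63`). [folklore] -/
theorem swe_coneDense {a : ℝ} (ha : 0 < a) (ha' : a ≤ 1 / 4) :
    ∀ h : ℝ → ℂ, IsWeilTest h → tsupport h ⊆ Set.Icc (-a) a → ∫ t, ‖h t‖ ^ 2 = (1 : ℝ) →
      ∀ δ : ℝ, 0 < δ →
        ∃ w : ℝ → ℂ, IsWeilTest w ∧ tsupport w ⊆ Set.Icc (-a) a ∧
          (∀ t, (w t).im = 0 ∧ 0 ≤ (w t).re) ∧ ∫ t, ‖w t‖ ^ 2 = (1 : ℝ) ∧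
          (weilQuadratic w).re ≤ (weilQuadratic h).re + δ :=
  stub_coneDense_of_even a ha
    (Summit.RiemannHypothesis.RiemannHypothesis.Theorems.WeilParity.evenSectorWins_upTo_63 a ha
      (by linarith))
    (swe_evenConeDense ha ha')

/-! ## `GSP a` at every window `0 < a ≤ 1/4` -/

/-- **Perron–Frobenius on every window `0 < a ≤ 1/4`**: the FULL windowed Weil form has a ground state
that is real and `≥ 0` almost everywhere (cone density ⇒ cone minimising sequence ⇒ compact ⇒ sign in
the limit). [folklore] -/
theorem swe_exists_nonneg_isWeilGroundState {a : ℝ} (ha : 0 < a) (ha' : a ≤ 1 / 4) :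
    ∃ u : ℝ → ℂ, IsWeilGroundState a u ∧ ∀ᵐ t : ℝ, (u t).im = 0 ∧ 0 ≤ (u t).re := by
  obtain ⟨g, hg, hQ⟩ := stub_coneMinimizingSeq a ha (swe_coneDense ha ha')
  have hg' : ∀ n, IsWeilTest (g n) ∧ tsupport (g n) ⊆ Icc (-a) a ∧ ∫ t, ‖g n t‖ ^ 2 = (1 : ℝ) :=
    fun n ↦ ⟨(hg n).1, (hg n).2.1, (hg n).2.2.2⟩
  obtain ⟨u, hu, φ, hφ, hconv⟩ :=
    ConnesConsaniMoscovici2025_thm_3_6_holds a ha g hg' hQ.bddAbove_range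
  have hQ' : Tendsto (fun n ↦ (weilQuadratic (g (φ n))).re) atTop (𝓝 (weilGroundEnergy a)) :=
    hQ.comp hφ.tendsto_atTop
  have hmem : ∀ n, MemLp (g (φ n)) 2 := fun n ↦ (hg' (φ n)).1.memLp_two
  have hsign := stub_aeNonneg_of_L2_limit (fun n ↦ g (φ n)) u hmem hu
    (fun n t ↦ (hg (φ n)).2.2.1 t) hconv
  exact ⟨u, ⟨hu, fun n ↦ g (φ n), fun n ↦ hg' (φ n), hQ', hconv⟩, hsign⟩

/-- **An even, real-valued, everywhere non-negative ground state at every window `0 < a ≤ 1/4`.**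
[folklore] -/
theorem swe_exists_even_real_nonneg_isWeilGroundState {a : ℝ} (ha : 0 < a) (ha' : a ≤ 1 / 4) :
    ∃ u : ℝ → ℂ, IsWeilGroundState a u ∧ (∀ t, u (-t) = u t) ∧ (∀ t, (u t).im = 0) ∧
      ∀ t, 0 ≤ (u t).re := by
  obtain ⟨u, hu, hsign⟩ := swe_exists_nonneg_isWeilGroundState ha ha'
  exact exists_even_real_nonneg_of_oneSigned hu (hsign.mono fun t ht _ ↦ ht)

/-- **`GSP a` in the route items' inline encoding, for every `0 < a ≤ 1/4`.** [folklore] -/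
theorem swe_GSP {a : ℝ} (ha : 0 < a) (ha' : a ≤ 1 / 4) :
    ∃ u : ℝ → ℂ, (MemLp u 2 ∧ ∃ g : ℕ → ℝ → ℂ,
      (∀ n, IsWeilTest (g n) ∧ tsupport (g n) ⊆ Icc (-a) a ∧ ∫ t, ‖g n t‖ ^ 2 = (1 : ℝ)) ∧
      (∀ h : ℝ → ℂ, IsWeilTest h → tsupport h ⊆ Icc (-a) a → ∫ t, ‖h t‖ ^ 2 = (1 : ℝ) →
        ∀ δ : ℝ, 0 < δ → ∀ᶠ n in atTop, (weilQuadratic (g n)).re ≤ (weilQuadratic h).re + δ) ∧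
      Tendsto (fun n ↦ ∫ t, ‖g n t - u t‖ ^ 2) atTop (𝓝 0)) ∧
      (∀ᵐ t : ℝ, t ∈ Ioo (-a) a → (u t).im = 0 ∧ 0 ≤ (u t).re) := by
  obtain ⟨u, hu, hsign⟩ := swe_exists_nonneg_isWeilGroundState ha ha'
  exact ⟨u, (isWeilGroundState_iff_forall_eventually_le a u).1 hu, hsign.mono fun t ht _ ↦ ht⟩

/-- **The matrix `EW a → GSP a` of the crux holds at every window `0 < a ≤ 1/4`** (indeed `GSP a`
does).  The crux asks for such windows beyond every height; its RH-bearing content lives at large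
windows. [folklore] -/
theorem swe_polarMatrix {a : ℝ} (ha : 0 < a) (ha' : a ≤ 1 / 4) :
    (∀ o : ℝ → ℂ, IsWeilTest o → tsupport o ⊆ Icc (-a) a → (∀ t, o (-t) = -o t) →
        ∫ t, ‖o t‖ ^ 2 = (1 : ℝ) → ∀ δ : ℝ, 0 < δ → ∃ w : ℝ → ℂ, IsWeilTest w ∧
          tsupport w ⊆ Icc (-a) a ∧ (∀ t, w (-t) = w t) ∧ ∫ t, ‖w t‖ ^ 2 = (1 : ℝ) ∧
          (weilQuadratic w).re ≤ (weilQuadratic o).re + δ) →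
      ∃ u : ℝ → ℂ, (MemLp u 2 ∧ ∃ g : ℕ → ℝ → ℂ,
        (∀ n, IsWeilTest (g n) ∧ tsupport (g n) ⊆ Icc (-a) a ∧ ∫ t, ‖g n t‖ ^ 2 = (1 : ℝ)) ∧
        (∀ h : ℝ → ℂ, IsWeilTest h → tsupport h ⊆ Icc (-a) a → ∫ t, ‖h t‖ ^ 2 = (1 : ℝ) →
          ∀ δ : ℝ, 0 < δ → ∀ᶠ n in atTop, (weilQuadratic (g n)).re ≤ (weilQuadratic h).re + δ) ∧
        Tendsto (fun n ↦ ∫ t, ‖g n t - u t‖ ^ 2) atTop (𝓝 0)) ∧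
        (∀ᵐ t : ℝ, t ∈ Ioo (-a) a → (u t).im = 0 ∧ 0 ≤ (u t).re) :=
  fun _ ↦ swe_GSP ha ha'

end Summit.RiemannHypothesis.RiemannHypothesis.Theorems.PolarPerronFrobenius

end
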